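import Summits.FinalStateConjecture.FinalStateConjecture.Statement
import Mathlib.MeasureTheory.Measure.MeasureSpace

/-!
# The pocket argument: first exit through the frontier, two-sphere nesting, and the deck-recentring endgame

Solo-blind programme on `FinalStateConjecture`, negative direction (bag-of-gold data), Note B §B14
("Case B closed: the pocket argument").  Three abstract steps of that section are recorded here; no
Lorentzian geometry is used.

* `soloBlind_exists_firstExit` / `soloBlind_path_subset_of_noFirstExit` (Lemma P, "the pocket is
  past-closed"): a path that starts in an open set `U` and leaves it has a FIRST EXIT parameter, at which it
  sits on `frontier U` having been inside `U` at all earlier parameters.  In Note B the path is a past-directed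
  timelike curve from the pocket `U` beneath the bottom leaf of the flat chart; the local structure of the
  frontier of the chart region (spacelike bottom, timelike walls) shows that no frontier point can be a first
  exit point, so the curve never leaves `U`.
* `soloBlind_subset_side_of_preconnected`, `soloBlind_not_mutually_inside`, `soloBlind_nested_of_inside`
  (Lemma N, "at most one inside-out wall"): for two disjoint separating spheres `S`, `S'` in a leaf, with
  small sides `D`, `D'` (finite measure) and big sides `B`, `B'` (infinite measure), the configuration
  "`S' ⊆ D` and `S ⊆ D'`" is impossible, and `S' ⊆ D`, `S ⊆ B'` force `D' ∪ S' ⊆ D` (strict nesting).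
* `soloBlind_pocket_endgame` (Theorem B14): a group `Γ` acts on `X` preserving a level function `σ` and a
  relation `≪`; `U ⊆ S` is `≪`-past-closed above level `c⋆` and contains points of arbitrarily high level;
  every point can be moved into a "fundamental region" `K`; (L5u) every `p` is `≪`-below all sufficiently
  high points of `K`; for `p` in the band `c⋆ < σ p < c⋆ + 1` only finitely many `g` have `g • p ∈ S`
  (proper discontinuity: the small side is relatively compact); and no single `g` moves the whole band into
  `S` (the big side is non-empty).  Then: contradiction — by a pigeonhole on the recentring deck elements.

Reference for the setting: B. O'Neill, Semi-Riemannian Geometry, Academic Press 1983, Ch. 14.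
-/

noncomputable section

open Set Filter MeasureTheory
open scoped Topology

set_option linter.dupNamespace false

namespace Summit.FinalStateConjecture.FinalStateConjecture.Theorems

section FirstExit

variable {X : Type*} [TopologicalSpace X]

/-- **First exit.**  A path `γ` on `[0,1]` starting in the open set `U` and not staying in `U` has a first
exit parameter `s₁ ∈ (0,1]`: `γ s₁ ∈ frontier U` and `γ s ∈ U` for all `s ∈ [0, s₁)`. -/
theorem soloBlind_exists_firstExit {U : Set X} (hU : IsOpen U) {γ : ℝ → X}
    (hγ : ContinuousOn γ (Icc 0 1)) (h0 : γ 0 ∈ U) (h1 : ∃ s ∈ Icc (0:ℝ) 1, γ s ∉ U) :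
    ∃ s₁ ∈ Ioc (0:ℝ) 1, γ s₁ ∈ frontier U ∧ ∀ s ∈ Ico 0 s₁, γ s ∈ U := by
  classical
  set Bad : Set ℝ := Icc 0 1 ∩ γ ⁻¹' Uᶜ with hBad
  have hBc : IsClosed Bad := hγ.preimage_isClosed_of_isClosed isClosed_Icc hU.isClosed_compl
  have hBne : Bad.Nonempty := by
    obtain ⟨s, hs, hsU⟩ := h1
    exact ⟨s, hs, hsU⟩
  have hBbdd : BddBelow Bad := ⟨0, fun s hs => hs.1.1⟩
  set s₁ := sInf Bad with hs₁def
  have hs₁B : s₁ ∈ Bad := hBc.csInf_mem hBne hBbdd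
  have hs₁U : γ s₁ ∉ U := hs₁B.2
  have hs₁0 : 0 ≤ s₁ := hs₁B.1.1
  have hs₁1 : s₁ ≤ 1 := hs₁B.1.2
  have hs₁ne : s₁ ≠ 0 := by
    intro h
    apply hs₁U
    rw [h]
    exact h0
  have hs₁pos : 0 < s₁ := lt_of_le_of_ne hs₁0 (Ne.symm hs₁ne)
  have hbefore : ∀ s ∈ Ico 0 s₁, γ s ∈ U := by
    intro s hs
    by_contra hsU
    have hsBad : s ∈ Bad := ⟨⟨hs.1, le_trans (le_of_lt hs.2) hs₁1⟩, hsU⟩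
    have : s₁ ≤ s := csInf_le hBbdd hsBad
    exact absurd hs.2 (not_lt.mpr this)
  have hcont : ContinuousWithinAt γ (Ico 0 s₁) s₁ :=
    (hγ s₁ hs₁B.1).mono (fun s hs => ⟨hs.1, le_trans (le_of_lt hs.2) hs₁1⟩)
  have hmemcl : s₁ ∈ closure (Ico (0:ℝ) s₁) := by
    rw [closure_Ico (Ne.symm hs₁ne)]
    exact right_mem_Icc.mpr hs₁0
  have hclU : γ s₁ ∈ closure U := by
    have h := hcont.mem_closure_image hmemcl
    exact closure_mono (image_subset_iff.mpr fun s hs => hbefore s hs) h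
  refine ⟨s₁, ⟨hs₁pos, hs₁1⟩, ?_, hbefore⟩
  rw [hU.frontier_eq]
  exact ⟨hclU, hs₁U⟩

/-- **No first exit ⇒ the path stays.**  If no frontier point of the open set `U` can be a first exit point
of the path `γ` (in Note B: the frontier of the chart region is a spacelike bottom leaf, crossable only
INTO the region, and timelike walls whose far sides are excluded from `U`), then `γ` stays in `U`. -/
theorem soloBlind_path_subset_of_noFirstExit {U : Set X} (hU : IsOpen U) {γ : ℝ → X}
    (hγ : ContinuousOn γ (Icc 0 1)) (h0 : γ 0 ∈ U)
    (hno : ∀ s₁ ∈ Ioc (0:ℝ) 1, γ s₁ ∈ frontier U → (∀ s ∈ Ico 0 s₁, γ s ∈ U) → False) :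
    ∀ s ∈ Icc (0:ℝ) 1, γ s ∈ U := by
  by_contra h
  push Not at h
  obtain ⟨s₁, hs₁, hfr, hbef⟩ := soloBlind_exists_firstExit hU hγ h0 h
  exact hno s₁ hs₁ hfr hbef

end FirstExit

section Nesting

variable {α : Type*} [TopologicalSpace α]

/-- A preconnected set missing the "sphere" `S`, whose complement is covered by the disjoint open sides
`D`, `B`, and which meets `D`, lies in `D`. -/
theorem soloBlind_subset_side_of_preconnected {S D B C : Set α} (hcov : Sᶜ ⊆ D ∪ B) (hD : IsOpen D)
    (hB : IsOpen B) (hDB : Disjoint D B) (hC : IsPreconnected C) (hCS : Disjoint C S)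
    (hCD : (C ∩ D).Nonempty) : C ⊆ D := by
  have hCcov : C ⊆ D ∪ B := fun x hx =>
    hcov (fun hxS => (Set.disjoint_left.mp hCS) hx hxS)
  exact hC.subset_left_of_subset_union hD hB hDB hCcov hCD

/-- **Two spheres are never mutually inside.**  `S`, `S'` disjoint; `Sᶜ ⊆ D ∪ B` with `D`, `B` open
disjoint, `μ D < ∞`; `D'`, `B'` the sides of `S'` with `B' ∪ S'` preconnected, `D' ∩ B' = ∅`, `μ B' = ∞`.
If `S' ⊆ D` (and `S'` is non-empty) then `S ⊆ D'` is impossible. -/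
theorem soloBlind_not_mutually_inside [MeasurableSpace α] (μ : Measure α) {S D B S' D' B' : Set α} (hcov : Sᶜ ⊆ D ∪ B)
    (hD : IsOpen D) (hB : IsOpen B) (hDB : Disjoint D B) (hμD : μ D < ⊤) (hSS' : Disjoint S S')
    (hS'ne : S'.Nonempty) (hD'B' : Disjoint D' B') (hC : IsPreconnected (B' ∪ S')) (hμB' : μ B' = ⊤)
    (hS'D : S' ⊆ D) (hSD' : S ⊆ D') : False := by
  -- `B' ∪ S'` misses `S`: `S ⊆ D'` is disjoint from `B'`, and `S ∩ S' = ∅`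
  have hmiss : Disjoint (B' ∪ S') S := by
    rw [Set.disjoint_union_left]
    refine ⟨Set.disjoint_left.mpr fun x hxB' hxS => ?_, hSS'.symm⟩
    exact (Set.disjoint_left.mp hD'B') (hSD' hxS) hxB'
  have hmeet : ((B' ∪ S') ∩ D).Nonempty := by
    obtain ⟨x, hx⟩ := hS'ne
    exact ⟨x, Or.inr hx, hS'D hx⟩
  have hsub : B' ∪ S' ⊆ D := soloBlind_subset_side_of_preconnected hcov hD hB hDB hC hmiss hmeet
  have hle : μ B' ≤ μ D := measure_mono (fun x hx => hsub (Or.inl hx))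
  rw [hμB'] at hle
  exact (ne_of_lt hμD) (le_antisymm le_top hle)

/-- **Nesting.**  With the same data, if `S' ⊆ D` and `S ⊆ B'` then the closed small side `D' ∪ S'` of
`S'` lies inside `D` (granted `D' ∪ S'` is preconnected): the small balls are strictly nested. -/
theorem soloBlind_nested_of_inside {S D B S' D' B' : Set α} (hcov : Sᶜ ⊆ D ∪ B) (hD : IsOpen D)
    (hB : IsOpen B) (hDB : Disjoint D B) (hSS' : Disjoint S S') (hS'ne : S'.Nonempty)
    (hD'B' : Disjoint D' B') (hC : IsPreconnected (D' ∪ S')) (hS'D : S' ⊆ D) (hSB' : S ⊆ B') :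
    D' ∪ S' ⊆ D := by
  have hmiss : Disjoint (D' ∪ S') S := by
    rw [Set.disjoint_union_left]
    refine ⟨Set.disjoint_left.mpr fun x hxD' hxS => ?_, hSS'.symm⟩
    exact (Set.disjoint_left.mp hD'B') hxD' (hSB' hxS)
  have hmeet : ((D' ∪ S') ∩ D).Nonempty := by
    obtain ⟨x, hx⟩ := hS'ne
    exact ⟨x, Or.inr hx, hS'D hx⟩
  exact soloBlind_subset_side_of_preconnected hcov hD hB hDB hC hmiss hmeet

/-- **Mutually exterior.**  If `S' ⊆ B` and `S ⊆ B'` then `D' ∪ S' ⊆ B`, so the small sides are disjoint. -/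
theorem soloBlind_exterior_of_outside {S D B S' D' B' : Set α} (hcov : Sᶜ ⊆ D ∪ B) (hD : IsOpen D)
    (hB : IsOpen B) (hDB : Disjoint D B) (hSS' : Disjoint S S') (hS'ne : S'.Nonempty)
    (hD'B' : Disjoint D' B') (hC : IsPreconnected (D' ∪ S')) (hS'B : S' ⊆ B) (hSB' : S ⊆ B') :
    D' ∪ S' ⊆ B ∧ Disjoint D D' := by
  have hmiss : Disjoint (D' ∪ S') S := by
    rw [Set.disjoint_union_left]
    refine ⟨Set.disjoint_left.mpr fun x hxD' hxS => ?_, hSS'.symm⟩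
    exact (Set.disjoint_left.mp hD'B') hxD' (hSB' hxS)
  have hmeet : ((D' ∪ S') ∩ B).Nonempty := by
    obtain ⟨x, hx⟩ := hS'ne
    exact ⟨x, Or.inr hx, hS'B hx⟩
  have hcov' : Sᶜ ⊆ B ∪ D := fun x hx => (hcov hx).symm
  have hsub : D' ∪ S' ⊆ B :=
    soloBlind_subset_side_of_preconnected hcov' hB hD hDB.symm hC hmiss hmeet
  refine ⟨hsub, Set.disjoint_left.mpr fun x hxD hxD' => ?_⟩
  exact (Set.disjoint_left.mp hDB) hxD (hsub (Or.inl hxD'))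

end Nesting

section Endgame

variable {G X : Type*} [Group G] [MulAction G X]

/-- **The endgame of Theorem B14 (deck recentring + pigeonhole + band).**
`σ` is a `G`-invariant level function, `lt` ("chronological precedence") is `G`-invariant, `U ⊆ S` is
past-closed above level `c⋆` (Lemma P) and reaches arbitrarily high levels, every point can be moved by some
`g` into the region `K`, (L5u) every `p` precedes all sufficiently high points of `K`, for `p` in the band
`c⋆ < σ p < c⋆ + 1` only finitely many `g` put `g • p` into `S`, and no `g` puts the whole band into `S`.
Contradiction. -/
theorem soloBlind_pocket_endgame (σ : X → ℝ) (lt : X → X → Prop) (S U K : Set X) (cstar : ℝ)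
    (hσ : ∀ (g : G) (x : X), σ (g • x) = σ x)
    (hlt : ∀ (g : G) (p q : X), lt p q → lt (g • p) (g • q))
    (hUS : U ⊆ S)
    (hpast : ∀ q ∈ U, ∀ p : X, lt p q → cstar < σ p → p ∈ U)
    (hhigh : ∀ F : ℝ, ∃ q ∈ U, F < σ q)
    (hcover : ∀ x : X, ∃ g : G, g • x ∈ K)
    (hL5u : ∀ p : X, ∃ F : ℝ, ∀ x ∈ K, F < σ x → lt p x)
    (hfin : ∀ p : X, cstar < σ p → σ p < cstar + 1 → {g : G | g • p ∈ S}.Finite)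
    (hband : ∃ p : X, cstar < σ p ∧ σ p < cstar + 1)
    (hnotall : ∀ g : G, ∃ p : X, cstar < σ p ∧ σ p < cstar + 1 ∧ g • p ∉ S) : False := by
  classical
  -- a sequence of pocket points of level `> n`, recentred into `K`
  have hseq : ∀ n : ℕ, ∃ q, q ∈ U ∧ (n : ℝ) < σ q := fun n => by
    obtain ⟨q, hq, hn⟩ := hhigh n
    exact ⟨q, hq, hn⟩
  choose q hqU hqσ using hseq
  choose g hg using fun n => hcover (q n)
  -- KEY: for `p` in the band and `n` large, `(g n)⁻¹ • p ∈ S`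
  have key : ∀ p : X, cstar < σ p → σ p < cstar + 1 → ∃ N : ℕ, ∀ n, N ≤ n → (g n)⁻¹ • p ∈ S := by
    intro p hp1 _hp2
    obtain ⟨F, hF⟩ := hL5u p
    obtain ⟨N, hN⟩ := exists_nat_gt F
    refine ⟨N, fun n hn => ?_⟩
    have hlev : F < σ (g n • q n) := by
      rw [hσ]
      have h1 : (N : ℝ) ≤ (n : ℝ) := Nat.cast_le.mpr hn
      linarith [hqσ n]
    have h1 : lt p (g n • q n) := hF _ (hg n) hlev
    have h2 : lt ((g n)⁻¹ • p) (q n) := by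
      have := hlt (g n)⁻¹ _ _ h1
      simpa [inv_smul_smul] using this
    have h3 : (g n)⁻¹ • p ∈ U := hpast (q n) (hqU n) _ h2 (by rw [hσ]; exact hp1)
    exact hUS h3
  obtain ⟨p₀, hp₀1, hp₀2⟩ := hband
  obtain ⟨N₀, hN₀⟩ := key p₀ hp₀1 hp₀2
  have hT : {g : G | g • p₀ ∈ S}.Finite := hfin p₀ hp₀1 hp₀2
  -- pigeonhole: some deck element recurs along the sequence
  have hrec : ∃ g₀ : G, ∀ N : ℕ, ∃ n, N ≤ n ∧ (g n)⁻¹ = g₀ := by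
    by_contra hcon
    push Not at hcon
    choose Nf hNf using hcon
    set M : ℕ := max N₀ (hT.toFinset.sup Nf) with hM
    have hMS : (g M)⁻¹ ∈ hT.toFinset := by
      rw [Set.Finite.mem_toFinset]
      exact hN₀ M (le_max_left _ _)
    have hle : Nf ((g M)⁻¹) ≤ M := le_trans (Finset.le_sup hMS) (le_max_right _ _)
    exact hNf ((g M)⁻¹) M hle rfl
  obtain ⟨g₀, hg₀⟩ := hrec
  obtain ⟨p, hp1, hp2, hpS⟩ := hnotall g₀
  obtain ⟨N, hN⟩ := key p hp1 hp2
  obtain ⟨n, hn, hgn⟩ := hg₀ N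
  exact hpS (hgn ▸ hN n hn)

end Endgame

end Summit.FinalStateConjecture.FinalStateConjecture.Theorems

end
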